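import Literature.Computability.MetaComplexity.EFModExpU
import HarnessLib

/-!
# The definition lines of a uniform modular multiplier as a list; weakening into a case context

Layer F/2, preparations for conditional congruences. `ModMulU.View.defList V L` lists all
definition lines of a multiplier `ModMulU.mulT` as seen through the view `V` (the zero gate,
per stage the doubling adder, the masks, the accumulating adder); availability is equivalent to
all of them being available (`forall_of_avail`, `avail_of_forall`). Weakening them into an
extended context `K ∨ A` (`Logic.weakLines`) makes the multiplier available under `K ∨ A`
(`ModMulU.View.avail_weak`), so the congruence laws run inside a case analysis.

## Sources

* S. A. Cook, R. A. Reckhow, *The relative efficiency of propositional proof systems*,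
  J. Symbolic Logic 44 (1979), §2.
-/

namespace Literature.Computability.MetaComplexity

open _root_.Computability Complexity Complexity.PropForm Netlist Cluster FregeSystem

namespace ModMulU

namespace View

variable (V : View) (L : ℕ)

/-- The definition lines of stage `s`: doubling, masks, accumulation. [folklore] -/
def stageDefList (s : ℕ) : List (PropForm ℕ) :=
  LD.modDefList (V.Dv L s) L ++ ((List.range L).map (V.mkDef L s) ++ LD.modDefList (V.Av L s) L)

/-- All definition lines of the multiplier. [folklore] -/
def defList : List (PropForm ℕ) := [biimp (var V.z) (const false)] ++ ((List.range L).map (V.stageDefList L)).flatten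

variable {V L} {K : PropForm ℕ} {Γ : Set (PropForm ℕ)}

/-- The definition list from availability. [folklore] -/
theorem forall_of_avail (h : V.Avail L K Γ) : ∀ θ ∈ V.defList L, ctx K θ ∈ Γ := by
  intro θ hθ
  rcases List.mem_append.1 hθ with hθ | hθ
  · rw [List.mem_singleton.1 hθ]; exact h.hz
  · obtain ⟨l, hl, hθ⟩ := List.mem_flatten.1 hθ
    obtain ⟨s, hs, rfl⟩ := List.mem_map.1 hl
    rw [List.mem_range] at hs
    rcases List.mem_append.1 hθ with hθ | hθ
    · exact LD.forall_of_modAvail (h.hD s hs) θ hθ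
    rcases List.mem_append.1 hθ with hθ | hθ
    · obtain ⟨i, hi, rfl⟩ := List.mem_map.1 hθ
      exact h.hmk s hs i (List.mem_range.1 hi)
    · exact LD.forall_of_modAvail (h.hA s hs) θ hθ

/-- Availability from the definition list. [folklore] -/
theorem avail_of_forall (h : ∀ θ ∈ V.defList L, ctx K θ ∈ Γ) : V.Avail L K Γ := by
  have hs : ∀ s < L, ∀ θ ∈ V.stageDefList L s, ctx K θ ∈ Γ := fun s hs θ hθ =>
    h θ (List.mem_append_right _ (List.mem_flatten.2 ⟨_, List.mem_map.2 ⟨s, List.mem_range.2 hs, rfl⟩, hθ⟩))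
  exact ⟨h _ (List.mem_append_left _ (List.mem_singleton_self _)),
    fun s hs' => LD.modAvail_of_forall fun θ hθ => hs s hs' θ (List.mem_append_left _ hθ),
    fun s hs' i hi => hs s hs' _ (List.mem_append_right _ (List.mem_append_left _ (List.mem_map.2 ⟨i, List.mem_range.2 hi, rfl⟩))),
    fun s hs' => LD.modAvail_of_forall fun θ hθ => hs s hs' θ (List.mem_append_right _ (List.mem_append_right _ hθ))⟩

/-- The items of the definition list are small. [folklore] -/
theorem size_le_of_mem_defList {θ : PropForm ℕ} (h : θ ∈ V.defList L) : θ.size ≤ 57 := by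
  rcases List.mem_append.1 h with h | h
  · rw [List.mem_singleton.1 h, FregeSystem.size_biimp]; simp [size]
  · obtain ⟨l, hl, h⟩ := List.mem_flatten.1 h
    obtain ⟨s, -, rfl⟩ := List.mem_map.1 hl
    rcases List.mem_append.1 h with h | h
    · exact LD.size_le_of_mem_modDefList h
    rcases List.mem_append.1 h with h | h
    · obtain ⟨i, -, rfl⟩ := List.mem_map.1 h
      rw [mkDef, FregeSystem.size_biimp]; simp [size]
    · exact LD.size_le_of_mem_modDefList h

/-- Length of the definition list. [folklore] -/
theorem length_defList (V : View) (L : ℕ) : (V.defList L).length = 1 + L * (13 * L + 4) := by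
  simp only [defList, List.length_append, List.length_singleton, List.length_flatten, List.map_map]
  rw [show (List.map (List.length ∘ V.stageDefList L) (List.range L)) = (List.range L).map (fun _ => 13 * L + 4) from
    List.map_congr_left fun s _ => by simp [stageDefList, LD.length_modDefList]; ring]
  simp [List.sum_replicate]

/-- **The multiplier is available under the extended context** after weakening its definitions.
[cite: CookReckhow1979, §2] -/
theorem avail_weak (A : PropForm ℕ) {T : Set (PropForm ℕ)} (hT : ∀ χ ∈ Logic.weakLines K A (V.defList L), χ ∈ T) :
    V.Avail L (disj K A) T :=
  avail_of_forall fun _ hθ => hT _ (Logic.mem_weakLines hθ)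

variable {G : FregeSystem}

/-- **The weakening block of a multiplier.** [cite: CookReckhow1979, §2] -/
theorem isBlock_weak (hGL : ∀ r ∈ Logic.rules, r ∈ G.rules) (A : PropForm ℕ) (h : V.Avail L K Γ) :
    G.IsBlock Γ (Logic.weakLines K A (V.defList L)) :=
  Logic.isBlock_weakLines hGL K A (forall_of_avail h)

/-- Size of the weakening block. [folklore] -/
theorem proofSize_weak (V : View) (L : ℕ) (K A : PropForm ℕ) :
    proofSize (Logic.weakLines K A (V.defList L)) ≤ (1 + L * (13 * L + 4)) * (K.size + A.size + 60) := by
  rw [← length_defList V L]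
  have : (Logic.weakLines K A (V.defList L)).length = (V.defList L).length := by simp [Logic.weakLines]
  rw [← this]
  refine ModAddU.Bounded.proofSize_le fun θ hθ => ?_
  obtain ⟨Lb, hLb, rfl⟩ := List.mem_map.1 hθ
  rw [ModAddU.size_ctx]; simp only [size]; have := size_le_of_mem_defList hLb; omega

end View

end ModMulU

end Literature.Computability.MetaComplexity
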